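import Mathlib
import Literature.NumberTheory.Transcendental.ZagierDilogarithmConjecture
import Summits.KontsevichZagierPeriods.KontsevichZagierPeriods.Theorems.HyperbolicBlochFiveTermTransfer
import Summits.KontsevichZagierPeriods.KontsevichZagierPeriods.Theorems.HyperbolicBlochSectorReduction
import Summits.KontsevichZagierPeriods.KontsevichZagierPeriods.Theorems.HyperbolicBlochZagierDilogarithmConjectureStubDistributionSlice
import HarnessLib

/-!
# `ZagierDilogarithmConjecture` (stmt-KontsevichZagierPeriods-10550) — line
`kummer-clausen-linearisation`, stub `stub_distributionKZ`

**The distribution relations among tetrahedron volumes are KZ relations, unconditionally.** For the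
standard KZ representations `ρ z = [T(z), t⁻³]` on the ideal tetrahedra with shapes `z ∈ ℍ⁺` and the
sign-corrected tetrahedron class `B w = [ρ w]` (`Im w > 0`), `−[ρ w̄]` (`Im w < 0`), `0` (`w` real)
of the route's `FiveTermTransfer`, every `N ≥ 1` and every algebraic `x ∈ ℂ` give
`B(xᴺ) − N · Σ_{m<N} B(ζ_Nᵐ x) ∈ KZ.relations` (`ζ_N = e^{2πi/N}`) — an infinite unconditional family
of relations of the Kontsevich–Zagier calculus among volumes of ideal hyperbolic tetrahedra.

Proof: the distribution slice of Zagier's dilogarithm conjecture holds unconditionally in the free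
abelian group on `ℂ` — `[xᴺ] − N · Σ_{m<N} [ζ_Nᵐ x] ∈ ⟨dilogRelators⟩`
(`ZagierDilogarithmGaloisDescent.stub_distributionSlice`, from Dupont's identity in the pre-Bloch
group of `ℚ̄`). Push it to the KZ level exactly as in `SectorReduction.sectorReduction_proof`: lift
`B` to `φ : FreeAbelianGroup ℂ →+ KZ.FormalRep` (`FreeAbelianGroup.lift`); `φ` maps five-term
relators into `KZ.relations` by the PROVED five-term transfer theorem `FiveTerm.FiveTermTransfer_of`,
and the relators `[w] + [w̄]`, `[w]` (`w` real) to `0` (`SectorReduction.B_add_B_conj_eq_zero`,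
`SectorReduction.B_eq_zero_of_im_eq_zero`), so `closure dilogRelators ≤ comap φ KZ.relations`
(`AddSubgroup.closure_le`); finally `φ ([xᴺ] − N · Σ [ζᵐ x]) = B(xᴺ) − N · Σ B(ζᵐ x)` because `φ` is
additive. Sorry-free; axioms ⊆ {propext, Classical.choice, Quot.sound}.
[cite: KontsevichZagier2001, §1.2] [cite: Dupont2001, Cor. 8.15]
-/

noncomputable section

open scoped BigOperators ComplexConjugate
open Literature.NumberTheory.Transcendental

namespace Summit.KontsevichZagierPeriods.HyperbolicBloch.ZagierDilogarithmCyclotomic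

/-- **Relators go to relations**: the additive extension `FreeAbelianGroup.lift B` of the
sign-corrected tetrahedron class `B` maps the subgroup generated by `dilogRelators` into
`KZ.relations` — five-term relators by `FiveTerm.FiveTermTransfer_of`, `[w] + [w̄]` and real `[w]`
to `0` by `SectorReduction.B_add_B_conj_eq_zero` / `SectorReduction.B_eq_zero_of_im_eq_zero`.
[cite: KontsevichZagier2001, §1.2] -/
theorem closure_dilogRelators_le_comap_lift
    (T : ℂ → Set (Fin 3 → ℝ)) (hT : ∀ z, T z = {p | 0 < p 1 ∧ z.re * p 1 < z.im * p 0 ∧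
      z.im * (p 0 - 1) < (z.re - 1) * p 1 ∧ 0 < p 2 ∧
      0 < z.im * (p 0 ^ 2 + p 1 ^ 2 + p 2 ^ 2 - p 0) + (z.re - Complex.normSq z) * p 1})
    (ρ : ℂ → KZ.IntegralRep 3) (hρ : ∀ z, IsAlgebraic ℚ z → 0 < z.im →
      (ρ z).domain = T z ∧ Set.EqOn (ρ z).integrand (fun p => 1 / p 2 ^ 3) (T z))
    (B : ℂ → KZ.FormalRep) (hB : ∀ z, B z = if 0 < z.im then KZ.of (ρ z)
      else if z.im < 0 then -KZ.of (ρ ((starRingEnd ℂ) z)) else 0) :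
    AddSubgroup.closure dilogRelators ≤ KZ.relations.comap (FreeAbelianGroup.lift B) := by
  have hφ : ∀ w, FreeAbelianGroup.lift B (FreeAbelianGroup.of w) = B w := fun w =>
    FreeAbelianGroup.lift_apply_of _ _
  rw [AddSubgroup.closure_le]
  rintro c ((⟨x, y, hx, hy, hx0, hx1, hy0, hy1, hxy, rfl⟩ | ⟨w, -, rfl⟩) | ⟨w, hw, rfl⟩)
  · simp only [SetLike.mem_coe, AddSubgroup.mem_comap, map_add, map_sub, hφ]
    exact FiveTerm.FiveTermTransfer_of T hT ρ hρ B hB x y hx hy hx0 hx1 hy0 hy1 hxy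
  · simp only [SetLike.mem_coe, AddSubgroup.mem_comap, map_add, hφ]
    rw [SectorReduction.B_add_B_conj_eq_zero ρ B hB w]
    exact zero_mem _
  · simp only [SetLike.mem_coe, AddSubgroup.mem_comap, hφ]
    rw [SectorReduction.B_eq_zero_of_im_eq_zero ρ B hB w hw]
    exact zero_mem _

/-- **Distribution relations at the KZ level** (stub `stub_distributionKZ` of line
`kummer-clausen-linearisation`): for the standard tetrahedral representations `ρ` and the
sign-corrected class `B`, every `N ≥ 1` and algebraic `x` give
`B(xᴺ) − N · Σ_{m<N} B(ζ_Nᵐ x) ∈ KZ.relations`. Pure algebra over the unconditional distribution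
slice `ZagierDilogarithmGaloisDescent.stub_distributionSlice` and the five-term transfer theorem
`FiveTerm.FiveTermTransfer_of`. [cite: Dupont2001, Cor. 8.15] -/
theorem stub_distributionKZ :
    ∀ (T : ℂ → Set (Fin 3 → ℝ)), (∀ z, T z = {p | 0 < p 1 ∧ z.re * p 1 < z.im * p 0 ∧
      z.im * (p 0 - 1) < (z.re - 1) * p 1 ∧ 0 < p 2 ∧
      0 < z.im * (p 0 ^ 2 + p 1 ^ 2 + p 2 ^ 2 - p 0) + (z.re - Complex.normSq z) * p 1}) →
    ∀ (ρ : ℂ → KZ.IntegralRep 3), (∀ z, IsAlgebraic ℚ z → 0 < z.im →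
      (ρ z).domain = T z ∧ Set.EqOn (ρ z).integrand (fun p => 1 / p 2 ^ 3) (T z)) →
    ∀ (B : ℂ → KZ.FormalRep), (∀ z, B z = if 0 < z.im then KZ.of (ρ z)
      else if z.im < 0 then -KZ.of (ρ ((starRingEnd ℂ) z)) else 0) →
    ∀ (N : ℕ), 0 < N → ∀ x : ℂ, IsAlgebraic ℚ x →
      B (x ^ N) - N • ∑ m ∈ Finset.range N, B (Complex.exp (2 * Real.pi * Complex.I / N) ^ m * x) ∈
        KZ.relations := by
  intro T hT ρ hρ B hB N hN x hx
  -- (1) the additive extension of the sign-corrected class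
  let φ : FreeAbelianGroup ℂ →+ KZ.FormalRep := FreeAbelianGroup.lift B
  have hφ : ∀ w, φ (FreeAbelianGroup.of w) = B w := fun w => FreeAbelianGroup.lift_apply_of _ _
  -- (2) every relator is mapped into `KZ.relations`
  have hle : AddSubgroup.closure dilogRelators ≤ KZ.relations.comap φ :=
    closure_dilogRelators_le_comap_lift T hT ρ hρ B hB
  -- (3) the unconditional distribution slice, pushed forward along `φ`
  have hmem := hle (ZagierDilogarithmGaloisDescent.stub_distributionSlice N hN x hx)
  rw [AddSubgroup.mem_comap, map_sub, map_nsmul, map_sum] at hmem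
  simpa only [hφ] using hmem

end Summit.KontsevichZagierPeriods.HyperbolicBloch.ZagierDilogarithmCyclotomic

end
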